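import Mathlib
import HarnessLib

/-!
# Descent of freeness along an injective integral extension of a semilocal ring

Topic `Literature/RingTheory/Flat`, namespace `Literature.RingTheory.Flat.FreeDescent`.  THEOREMS ONLY; no definition, no
named fact, no instance, no notation, no `sorry`.

THE STATEMENT.  Let `A → B` be an INJECTIVE map of commutative rings with `B` integral over `A` (e.g. a finite `A`-module),
`A` SEMILOCAL (finitely many maximal ideals — e.g. Artinian, e.g. a finite-dimensional algebra over a field), and `M` a
finite `A`-module whose base change `B ⊗[A] M` is FREE of rank `n` over `B`.  Then `M` is free of rank `n` over `A`
(**`nonempty_basis_of_basis_baseChange`**, `free_of_basis_baseChange`, `finrank_eq_of_basis_baseChange`, and the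
`Module.Free`-hypothesis forms `nonempty_basis_of_free_baseChange` / `free_of_free_baseChange`).  This is the commutative,
semilocal form of the «`W ⊗ V` free ⇒ `W` free» step in the Nichols–Zoeller ∕ Waterhouse freeness theorems for Hopf
algebras ([Montgomery1993Hopf] Prop. 3.1.2–Thm. 3.1.5, [Waterhouse1979] §14.1), isolated as pure commutative algebra; with
`Flat A M` in place of the base-change hypothesis it is [StacksProject, Tag 02M9] (Mathlib
`Module.nonempty_basis_of_flat_of_finrank_eq`), whose Chinese-remainder skeleton the proof reuses.

PROOF.  (1) `finrank_quotient_tensor_eq`: for a maximal `Q ⊂ B` over a maximal `P ⊂ A` (lying-over, `B` integral, `A → B`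
injective), `κ(Q) ⊗[A] M ≅ κ(Q) ⊗[B] (B ⊗[A] M) ≅ κ(Q)ⁿ` and `κ(Q) ⊗[A] M ≅ κ(Q) ⊗[κ(P)] (κ(P) ⊗[A] M)`, so every fibre
`κ(P) ⊗[A] M` has dimension `n`.  (2) By the Chinese remainder theorem for modules (Mathlib
`Ideal.pi_tensorProductMk_quotient_surjective`) choose `v₁ … vₙ ∈ M` reducing to a basis of every fibre.  (3) They SPAN:
`M ≤ ⟨v⟩ + (⋂ P) M` by lifting fibre coordinates simultaneously (CRT again, `Ideal.ker_tensorProductMk_quotient`), and `⋂ P`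
is the Jacobson radical (Nakayama, `Submodule.le_of_le_smul_of_le_jacobson_bot`).  (4) They are INDEPENDENT: the surjection
`Aⁿ ↠ M` becomes after `B ⊗[A] –` a surjective endomorphism `Bⁿ ↠ B ⊗[A] M ≅ Bⁿ`, hence injective (Orzech property of
commutative rings, `OrzechProperty.injective_of_surjective_endomorphism`); so a relation `∑ gᵢ vᵢ = 0` forces `1 ⊗ g = 0` in
`B ⊗[A] Aⁿ ≅ Bⁿ`, i.e. every `gᵢ ↦ 0` in `B`, i.e. `gᵢ = 0`.  No flatness of `M`, no descent theory.

Written for cell `hodgecm-mathlib` (D-0151), programme P6 «MOD», organ (W14) «a finite commutative Hopf algebra is free over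
a Hopf subalgebra» (`RingTheory/HopfAlgebra/FreeOverSubbialgebra`, which feeds `B ⊗[A] B ≅ B ⊗ₖ (B ⧸ A⁺B)` into this file);
count-neutral Mathlib-side capital: HC_CM is proved only modulo the 7 printed citations until rung 0 closes; nothing here
bears on it.

## References
* [StacksProject] The Stacks Project, Tag 02M9 (finite flat module of constant rank over a semilocal ring is free), Tag 00DV
  (Nakayama).
* [Montgomery1993Hopf] S. Montgomery, *Hopf algebras and their actions on rings*, CBMS 82 (1993), §3.1: Prop. 3.1.2 (p. 29),
  Thm. 3.1.5 (Nichols–Zoeller), Cor. 3.2.1.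
* [Waterhouse1979] W. C. Waterhouse, *Introduction to Affine Group Schemes*, GTM 66 (1979), §14.1 (faithful flatness over Hopf
  subalgebras).
-/

set_option autoImplicit false

open TensorProduct Module Function

namespace Literature.RingTheory.Flat

namespace FreeDescent

universe u v w

variable {A : Type u} {B : Type v} (M : Type w) [CommRing A] [CommRing B] [Algebra A B]
  [AddCommGroup M] [Module A M]

/-- **Fibre ranks.** If `B ⊗[A] M` is free of rank `n` over `B` and the maximal ideal `Q ⊂ B` lies over the maximal ideal
`P ⊂ A`, then `κ(P) ⊗[A] M` has dimension `n` over `κ(P) = A ⧸ P`: both `κ(Q) ⊗[A] M ≅ κ(Q) ⊗[B] (B ⊗[A] M) ≅ κ(Q)ⁿ`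
and `κ(Q) ⊗[A] M ≅ κ(Q) ⊗[κ(P)] (κ(P) ⊗[A] M)`. [cite: StacksProject, Tag 02M9] -/
theorem finrank_quotient_tensor_eq (P : Ideal A) [P.IsMaximal] (Q : Ideal B) [Q.IsMaximal]
    (hPQ : P ≤ Q.comap (algebraMap A B)) {n : ℕ} (b : Basis (Fin n) B (B ⊗[A] M)) :
    finrank (A ⧸ P) ((A ⧸ P) ⊗[A] M) = n := by
  letI := Ideal.Quotient.field P
  letI := Ideal.Quotient.field Q
  letI : Algebra (A ⧸ P) (B ⧸ Q) := Ideal.Quotient.algebraQuotientOfLEComap hPQ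
  haveI : IsScalarTower A (A ⧸ P) (B ⧸ Q) :=
    IsScalarTower.of_algebraMap_eq (fun a => rfl)
  have e₁ : (B ⧸ Q) ⊗[A] M ≃ₗ[B ⧸ Q] (Fin n → B ⧸ Q) :=
    (AlgebraTensorModule.cancelBaseChange A B (B ⧸ Q) (B ⧸ Q) M).symm ≪≫ₗ
      (AlgebraTensorModule.congr (LinearEquiv.refl (B ⧸ Q) (B ⧸ Q)) b.equivFun) ≪≫ₗ
      TensorProduct.piScalarRight B (B ⧸ Q) (B ⧸ Q) (Fin n)
  have e₂ : (B ⧸ Q) ⊗[A] M ≃ₗ[B ⧸ Q] (B ⧸ Q) ⊗[A ⧸ P] ((A ⧸ P) ⊗[A] M) :=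
    (AlgebraTensorModule.cancelBaseChange A (A ⧸ P) (B ⧸ Q) (B ⧸ Q) M).symm
  have h₁ : finrank (B ⧸ Q) ((B ⧸ Q) ⊗[A] M) = n := by
    rw [e₁.finrank_eq, Module.finrank_fin_fun]
  have h₂ : finrank (B ⧸ Q) ((B ⧸ Q) ⊗[A] M) = finrank (A ⧸ P) ((A ⧸ P) ⊗[A] M) := by
    rw [e₂.finrank_eq, Module.finrank_baseChange]
  rw [← h₂, h₁]

section Semilocal

variable [Finite (MaximalSpectrum A)] [Module.Finite A M] [Algebra.IsIntegral A B]

/-- **Descent of freeness along an injective integral extension of a semilocal ring.**  Let `A → B` be an injective ring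
map with `B` integral over `A` (e.g. `B` a finite `A`-module), `A` with finitely many maximal ideals, and `M` a finite
`A`-module such that `B ⊗[A] M` is free of rank `n` over `B`.  Then `M` is free of rank `n` over `A`.
PROOF. Every fibre `κ(P) ⊗ M` has dimension `n` (`finrank_quotient_tensor_eq`, a maximal `Q ⊂ B` over `P` exists by
lying-over); by the Chinese remainder theorem choose `v₁ … vₙ ∈ M` reducing to a basis of every fibre; they SPAN `M`
(Nakayama over the Jacobson radical `⋂ P`), and the surjection `Aⁿ ↠ M` becomes, after `B ⊗[A] -`, a surjective
endomorphism `Bⁿ ↠ B ⊗[A] M ≅ Bⁿ`, hence injective (Orzech property of commutative rings); so a relation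
`∑ gᵢ vᵢ = 0` gives `1 ⊗ g = 0` in `B ⊗[A] Aⁿ = Bⁿ`, i.e. every `gᵢ` dies in `B`, hence `gᵢ = 0` by injectivity.
[cite: StacksProject, Tag 02M9; Montgomery1993Hopf, Prop. 3.1.2 (p. 29)] -/
theorem nonempty_basis_of_basis_baseChange (hinj : Function.Injective (algebraMap A B)) {n : ℕ}
    (b : Basis (Fin n) B (B ⊗[A] M)) : Nonempty (Basis (Fin n) A M) := by
  classical
  letI := @Ideal.Quotient.field
  -- pairwise coprimality of the maximal ideals
  have hcop : Pairwise (IsCoprime on fun P : MaximalSpectrum A => P.asIdeal) :=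
    fun _ _ ne => Ideal.isCoprime_of_isMaximal (MaximalSpectrum.ext_iff.ne.mp ne)
  -- (1) every fibre has dimension `n`
  have rk : ∀ P : MaximalSpectrum A, finrank (A ⧸ P.asIdeal) ((A ⧸ P.asIdeal) ⊗[A] M) = n := by
    intro P
    obtain ⟨Q, hQ, hQP⟩ := Ideal.exists_ideal_over_maximal_of_isIntegral (S := B) P.asIdeal
      (by rw [(RingHom.injective_iff_ker_eq_bot _).mp hinj]; exact bot_le)
    haveI := hQ
    exact finrank_quotient_tensor_eq M P.asIdeal Q hQP.ge b
  have b' : ∀ P : MaximalSpectrum A, Basis (Fin n) (A ⧸ P.asIdeal) ((A ⧸ P.asIdeal) ⊗[A] M) :=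
    fun P => Module.finBasisOfFinrankEq _ _ (rk P)
  -- (2) CRT: elements `v i` reducing to `b' P i` in every fibre
  choose v hv using fun i => Ideal.pi_tensorProductMk_quotient_surjective M _ hcop (b' · i)
  -- (3) they span `M` (Nakayama over the Jacobson radical)
  have hspan : Submodule.span A (Set.range v) = ⊤ := by
    set N := Submodule.span A (Set.range v) with hN
    let Φ : M →ₗ[A] (∀ P : MaximalSpectrum A, (A ⧸ P.asIdeal) ⊗[A] M) :=
      LinearMap.pi fun P => TensorProduct.mk A (A ⧸ P.asIdeal) M 1
    have hker : LinearMap.ker Φ = (⨅ P : MaximalSpectrum A, P.asIdeal) • ⊤ :=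
      Ideal.ker_tensorProductMk_quotient M _ hcop
    have hjac : (⨅ P : MaximalSpectrum A, P.asIdeal) ≤ Ideal.jacobson (⊥ : Ideal A) := by
      refine le_sInf fun J hJ => ?_
      exact iInf_le_of_le ⟨J, hJ.2⟩ le_rfl
    have htop : (⊤ : Submodule A M) ≤ N ⊔ (⨅ P : MaximalSpectrum A, P.asIdeal) • ⊤ := by
      intro m _
      -- lift the coordinates of `1 ⊗ m` in every fibre simultaneously
      obtain ⟨a, ha⟩ : ∃ a : Fin n → A, ∀ i (P : MaximalSpectrum A),
          Ideal.Quotient.mk P.asIdeal (a i) = (b' P).repr (1 ⊗ₜ[A] m) i := by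
        have hs := Ideal.pi_mkQ_surjective hcop
        choose a ha using fun i => hs fun P => (b' P).repr (1 ⊗ₜ[A] m) i
        exact ⟨a, fun i P => by simpa using congr_fun (ha i) P⟩
      have hy : (∑ i, a i • v i) ∈ N :=
        Submodule.sum_mem _ fun i _ => Submodule.smul_mem _ _ (Submodule.subset_span ⟨i, rfl⟩)
      have hdiff : m - ∑ i, a i • v i ∈ LinearMap.ker Φ := by
        rw [LinearMap.mem_ker, map_sub, sub_eq_zero]
        funext P
        simp only [Φ, LinearMap.pi_apply, TensorProduct.mk_apply, map_sum, map_smul]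
        conv_lhs => rw [← (b' P).sum_repr (1 ⊗ₜ[A] m)]
        refine Finset.sum_congr rfl fun i _ => ?_
        have hvi : (1 : A ⧸ P.asIdeal) ⊗ₜ[A] v i = b' P i := by
          have := congr_fun (hv i) P
          simpa [LinearMap.pi_apply] using this
        rw [← hvi, ← ha i P, ← Ideal.Quotient.algebraMap_eq, algebraMap_smul]
      rw [hker] at hdiff
      have hm : m = (∑ i, a i • v i) + (m - ∑ i, a i • v i) := by abel
      rw [hm]
      exact Submodule.add_mem_sup hy hdiff
    exact top_le_iff.mp
      (Submodule.le_of_le_smul_of_le_jacobson_bot (N := N) Module.Finite.fg_top hjac htop)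
  -- (4) they are linearly independent (Orzech after base change to `B`)
  have hli : LinearIndependent A v := by
    rw [Fintype.linearIndependent_iff]
    intro g hg i
    let lc : (Fin n → A) →ₗ[A] M := Fintype.linearCombination A v
    have hlc : Function.Surjective lc := by
      rw [← LinearMap.range_eq_top, Fintype.range_linearCombination, hspan]
    let e₀ : B ⊗[A] (Fin n → A) ≃ₗ[B] (Fin n → B) := TensorProduct.piScalarRight A B B (Fin n)
    let g' : (Fin n → B) →ₗ[B] (Fin n → B) :=
      (b.equivFun.toLinearMap ∘ₗ lc.baseChange B) ∘ₗ e₀.symm.toLinearMap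
    have hlcB : Function.Surjective (lc.baseChange B) := by
      rw [LinearMap.baseChange_eq_ltensor]
      exact LinearMap.lTensor_surjective B hlc
    have hg' : Function.Surjective g' :=
      b.equivFun.surjective.comp (hlcB.comp e₀.symm.surjective)
    have hg'inj : Function.Injective g' := OrzechProperty.injective_of_surjective_endomorphism g' hg'
    have hlcBinj : Function.Injective (lc.baseChange B) := by
      intro x y hxy
      have : g' (e₀ x) = g' (e₀ y) := by simp [g', hxy]
      simpa using hg'inj this
    have h1 : lc.baseChange B ((1 : B) ⊗ₜ[A] g) = 0 := by
      rw [LinearMap.baseChange_tmul]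
      change (1 : B) ⊗ₜ[A] (∑ i, g i • v i) = 0
      rw [hg, tmul_zero]
    have h2 : (1 : B) ⊗ₜ[A] g = 0 := hlcBinj (by rw [h1, map_zero])
    have h3 : e₀ ((1 : B) ⊗ₜ[A] g) i = algebraMap A B (g i) := by
      simp [e₀, TensorProduct.piScalarRight_apply, TensorProduct.piScalarRightHom_tmul, Algebra.algebraMap_eq_smul_one]
    rw [h2, map_zero, Pi.zero_apply] at h3
    exact hinj (by rw [← h3, map_zero])
  exact ⟨Basis.mk hli hspan.ge⟩

/-- **`M` is free** under the hypotheses of `nonempty_basis_of_basis_baseChange`.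
[cite: StacksProject, Tag 02M9; Montgomery1993Hopf, Prop. 3.1.2 (p. 29)] -/
theorem free_of_basis_baseChange (hinj : Function.Injective (algebraMap A B)) {n : ℕ}
    (b : Basis (Fin n) B (B ⊗[A] M)) : Module.Free A M :=
  let ⟨c⟩ := nonempty_basis_of_basis_baseChange M hinj b
  Module.Free.of_basis c

/-- **`finrank A M = n`** under the hypotheses of `nonempty_basis_of_basis_baseChange` (for `A` nontrivial).
[cite: StacksProject, Tag 02M9; Montgomery1993Hopf, Prop. 3.1.2 (p. 29)] -/
theorem finrank_eq_of_basis_baseChange [Nontrivial A] (hinj : Function.Injective (algebraMap A B)) {n : ℕ}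
    (b : Basis (Fin n) B (B ⊗[A] M)) : finrank A M = n := by
  obtain ⟨c⟩ := nonempty_basis_of_basis_baseChange M hinj b
  simpa using Module.finrank_eq_card_basis c

/-- **`Module.Free` form.** If `B` is nontrivial and `B ⊗[A] M` is a free `B`-module (it is automatically finite), then `M` is
free over `A`, of the same rank. [cite: StacksProject, Tag 02M9; Montgomery1993Hopf, Prop. 3.1.2 (p. 29)] -/
theorem nonempty_basis_of_free_baseChange [Nontrivial B] (hinj : Function.Injective (algebraMap A B))
    [Module.Free B (B ⊗[A] M)] : Nonempty (Basis (Fin (finrank B (B ⊗[A] M))) A M) :=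
  nonempty_basis_of_basis_baseChange M hinj (Module.finBasis B (B ⊗[A] M))

/-- **`Module.Free` form, conclusion `Module.Free A M`.** [cite: StacksProject, Tag 02M9; Montgomery1993Hopf, Prop. 3.1.2 (p. 29)] -/
theorem free_of_free_baseChange [Nontrivial B] (hinj : Function.Injective (algebraMap A B))
    [Module.Free B (B ⊗[A] M)] : Module.Free A M :=
  let ⟨c⟩ := nonempty_basis_of_free_baseChange M hinj
  Module.Free.of_basis c

/-- **Rank.** `finrank A M = finrank B (B ⊗[A] M)` under the same hypotheses. [cite: StacksProject, Tag 02M9; Montgomery1993Hopf, Prop. 3.1.2 (p. 29)] -/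
theorem finrank_eq_finrank_baseChange [Nontrivial B] (hinj : Function.Injective (algebraMap A B))
    [Module.Free B (B ⊗[A] M)] : finrank A M = finrank B (B ⊗[A] M) := by
  haveI : Nontrivial A := (algebraMap A B).domain_nontrivial
  obtain ⟨c⟩ := nonempty_basis_of_free_baseChange M hinj
  simpa using Module.finrank_eq_card_basis c

end Semilocal

end FreeDescent

end Literature.RingTheory.Flat
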